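import Mathlib
import Literature.AlgebraicGeometry.Resolution.BlowupsExistence
import HarnessLib

/-!
# WLOG `U = X − D` with `D` an effective Cartier divisor, by a `U`-admissible blow-up
# (crux `WildQuotients.WildQuotientResolution`, stub `stub_phaseZeroHighDim`: step (P0) of the port of (H1))

Crux stmt-ResolutionOfSingularities-15640 (`WildQuotientResolution`), registered stub `stub_phaseZeroHighDim`,
residual (H1) = `Literature.AlgebraicGeometry.Ramification.AbbesSaito2011_inertiaNormalSylow_after_admissibleBlowup`
(Abbes–Saito 2011, Prop. 2.22). The printed proof of 2.22 opens with: "Replacing `X` by a `U`-admissible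
blow-up, we may assume that there exists an effective Cartier divisor `D` on `X` such that `U = X − D`". This
file proves that first step for the tree's blow-ups (`IsBlowup`, universal property) on a locally Noetherian
scheme: blow up the VANISHING ideal sheaf of the closed set `X − U` (Mathlib `Scheme.IdealSheafData.vanishingIdeal`,
support exactly `X − U`; of finite type because affine sections of a locally Noetherian scheme are Noetherian
rings); by the universal property its inverse image is an effective Cartier divisor whose support is exactly the
complement of the preimage of `U`.

* `exists_admissibleBlowup_compl_isEffectiveCartier` — for `X` locally Noetherian and `U ⊆ X` open there are a
  blowing up `φ : X' → X` in an ideal sheaf `I` of finite type with `supp I = X − U` (so `U`-admissible: support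
  disjoint from `U`) such that `I·𝒪_{X'}` is an effective Cartier divisor with support `X' − φ⁻¹U`.

[OURS · crux stmt-ResolutionOfSingularities-15640 · helper toward `stub_phaseZeroHighDim` (step P0 of the port of
the named fact (H1); NOT a proof of the stub); counted 0; AI-level work, weaker than expert review.]
[cite: AbbesSaito2011, Prop. 2.22 (proof, first sentence)] [cite: StacksProject, Tag 080K]
-/

-- single-problem summit: the doubled namespace component `ResolutionOfSingularities` is forced
set_option linter.dupNamespace false

noncomputable section

open CategoryTheory AlgebraicGeometry TopologicalSpace
open Literature.AlgebraicGeometry.Resolution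

namespace Summit.ResolutionOfSingularities.ResolutionOfSingularities.Theorems.WildQuotientResolution.AdmissibleBlowupCompl

universe u

/-- On a locally Noetherian scheme every ideal sheaf is of finite type (its sections over affine opens are
ideals of Noetherian rings). [folklore] -/
theorem fg_ideal_of_isLocallyNoetherian {X : Scheme.{u}} [IsLocallyNoetherian X] (I : X.IdealSheafData)
    (W : X.affineOpens) : (I.ideal W).FG :=
  haveI : IsNoetherianRing Γ(X, W) := IsLocallyNoetherian.component_noetherian W
  IsNoetherian.noetherian _

/-- **(P0) WLOG `U = X − D`, `D` effective Cartier.** For a locally Noetherian scheme `X` and an open `U ⊆ X`: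
a blowing up `φ : X' → X` of `X` in an ideal sheaf `I` OF FINITE TYPE with support EXACTLY `X − U` (hence
`U`-admissible), whose inverse image ideal sheaf `I·𝒪_{X'}` is an effective Cartier divisor with support
`X' − φ⁻¹(U)`. (Centre: the vanishing ideal sheaf of the closed set `X − U`.)
[cite: AbbesSaito2011, Prop. 2.22 (proof)] [cite: StacksProject, Tag 080K] -/
theorem exists_admissibleBlowup_compl_isEffectiveCartier {X : Scheme.{u}} [IsLocallyNoetherian X]
    (U : X.Opens) :
    ∃ (X' : Scheme.{u}) (φ : X' ⟶ X) (I : X.IdealSheafData),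
      IsBlowup φ I ∧ (∀ W : X.affineOpens, (I.ideal W).FG) ∧
      (I.support : Set X) = (U : Set X)ᶜ ∧ Disjoint (U : Set X) (I.support : Set X) ∧
      IsEffectiveCartier (I.comap φ) ∧ ((I.comap φ).support : Set X') = ((φ ⁻¹ᵁ U : X'.Opens) : Set X')ᶜ := by
  let Z : Closeds X := ⟨(U : Set X)ᶜ, U.2.isClosed_compl⟩
  let I : X.IdealSheafData := Scheme.IdealSheafData.vanishingIdeal Z
  have hI : (I.support : Set X) = (U : Set X)ᶜ := Scheme.IdealSheafData.coe_support_vanishingIdeal Z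
  obtain ⟨X', φ, hφ⟩ := exists_isBlowup X I
  refine ⟨X', φ, I, hφ, fun W => fg_ideal_of_isLocallyNoetherian I W, hI, ?_, hφ.isEffectiveCartier, ?_⟩
  · rw [hI]; exact disjoint_compl_right
  · rw [Scheme.IdealSheafData.support_comap]
    change φ.base ⁻¹' (I.support : Set X) = _
    rw [hI]
    rfl

end Summit.ResolutionOfSingularities.ResolutionOfSingularities.Theorems.WildQuotientResolution.AdmissibleBlowupCompl

end
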